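import Summits.NavierStokesRegularity.FluidComputer.ClayBlowupZoomOfData
import Summits.NavierStokesRegularity.FluidComputer.ClayBlowupSingularSliceAxis
import HarnessLib

/-!
# THE ZOOM WITH FORCE, AXISYMMETRIC NORMALISATION: for an axisymmetric Clay blow-up the zoom
# centres can be taken on the meridian half-plane `{x₁ = 0, x₀ ≥ 0}`

Cell `ns-blowup`, seat `ns-blowup-ecbridge-2` (g10; the E–C endpoint theory seat). LABEL: E–C typing
(KERNEL — no named fact). WHAT THIS IS NOT: not Navier–Stokes evidence — a necessary STRUCTURE of
the TYPE `ClayBlowup 1` (no inhabitant is claimed anywhere). Companion memo: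
`run/shared/lean/pub/ns-blowup/ecbridge2/ECBRIDGE-2-MEMO-9.md`.

For an axisymmetric blow-up (datum and Clay force axisymmetric, hence all slices —
`ClayBlowup.isAxisymmetric`) the near-maximum points may be rotated about the axis onto the meridian
half-plane `{x₁ = 0, x₀ ≥ 0}` without changing any of the zoom data (`‖u(t, R_θ x)‖ = ‖u(t, x)‖`).
With such centres the zoom `w_k(s, y) = c_k u(t_k + c_k² s, x_k + c_k y)` is axisymmetric about the
vertical axis through `−c_k⁻¹ (x_k)₀ e₀ = −M_k r(x_k) e₀` — the normalisation in which the tree's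
Type-II inner-limit dictionary (`Summits/NavierStokesRegularity/OSWSelfSimilar/TypeIIInnerLimit*`:
axis-centred Case A, receding Case B about axes through `−M e₀`) is written. So the (C)-type inner
object WITH the Clay force plugs into that dictionary.

* `exists_rotZ_mem_halfPlane` — every point is rotated about the axis onto the half-plane;
* `ClayBlowup.exists_zoom_data_halfPlane` — `exists_zoom_data` with centres on the half-plane;
* **`ClayBlowup.exists_zoom_limit_halfPlane`** — `exists_zoom_limit` with centres on the half-plane
  (through `exists_zoom_limit_of_data`), for axisymmetric datum and force;
* `ClayBlowup.zoom_halfPlane_rot_about` — the zoom slices are then axisymmetric about the vertical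
  axis through `−(c_k⁻¹ (x_k) 0) • e₀`, whenever the slice time lies in `[0, T)`.

References: Koch–Nadirashvili–Seregin–Šverák, Acta Math. 203 (2009), §6, proof of Thm 6.1
(«v⁽ᵏ⁾ are axi-symmetric with respect to an axis parallel to the y₃-axis») and of Thm 6.2
[cite: KochNadirashviliSereginSverak2009, proof of Thm 6.1 (arXiv p. 12)]; C. L. Fefferman, (C)
[cite: FeffermanClay2006, (C)].
-/

noncomputable section

namespace Summit.NavierStokesRegularity.FluidComputer

open Set MeasureTheory Filter Topology Function Metric
open scoped ENNReal NNReal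
open Literature.Analysis Literature.Analysis.FluidPDE
open Literature.Analysis.FluidPDE.SereginSverak2009
open Summit.NavierStokesRegularity.NavierStokesRegularity

/-! ## §1 Rotating a point onto the meridian half-plane -/

/-- **Every point of `ℝ³` is carried by a rotation about the vertical axis onto the meridian
half-plane `{x₁ = 0, x₀ ≥ 0}`** (rotate by minus the polar angle of `(x₀, x₁)`). [folklore] -/
theorem exists_rotZ_mem_halfPlane (x : EuclideanSpace ℝ (Fin 3)) :
    ∃ θ : ℝ, rotZ θ x 1 = 0 ∧ 0 ≤ rotZ θ x 0 := by
  set z : ℂ := ⟨x 0, x 1⟩ with hz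
  by_cases h0 : z = 0
  · have hx0 : x 0 = 0 := by have := congrArg Complex.re h0; simpa [hz] using this
    have hx1 : x 1 = 0 := by have := congrArg Complex.im h0; simpa [hz] using this
    exact ⟨0, by simp [hx1], by simp [hx0]⟩
  · have hn : ‖z‖ ≠ 0 := norm_ne_zero_iff.2 h0
    have hn0 : 0 < ‖z‖ := norm_pos_iff.2 h0
    have hcos : Real.cos (-Complex.arg z) = x 0 / ‖z‖ := by
      rw [Real.cos_neg, Complex.cos_arg h0]
    have hsin : Real.sin (-Complex.arg z) = -(x 1 / ‖z‖) := by
      rw [Real.sin_neg, Complex.sin_arg]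
    refine ⟨-Complex.arg z, ?_, ?_⟩
    · rw [rotZ_apply_one, hcos, hsin]
      field_simp
      ring
    · rw [rotZ_apply_zero, hcos, hsin]
      have : x 0 / ‖z‖ * x 0 - -(x 1 / ‖z‖) * x 1 = (x 0 * x 0 + x 1 * x 1) / ‖z‖ := by
        field_simp
        ring
      rw [this]
      exact div_nonneg (by nlinarith [sq_nonneg (x 0), sq_nonneg (x 1)]) hn0.le

namespace ClayBlowup

/-! ## §2 Zoom data with centres on the half-plane -/

/-- **Zoom data with centres on the meridian half-plane** (`ν = 1`, axisymmetric slices): the data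
of `exists_zoom_data`, with every centre `x_k` rotated about the axis onto `{x₁ = 0, x₀ ≥ 0}`
(the seven properties only see `‖u(t_k, x_k)‖ = ‖u(t_k, R_θ x_k)‖`).
[cite: KochNadirashviliSereginSverak2009, proof of Thm 6.1 (arXiv p. 12)] -/
theorem exists_zoom_data_halfPlane (X : ClayBlowup 1)
    (hax : ∀ t ∈ Ico 0 X.T, IsAxisymmetric (X.u t)) :
    ∃ δ : ℝ, 0 < δ ∧ ∃ G : ℝ, 0 ≤ G ∧
      ∃ (t : ℕ → ℝ) (x : ℕ → EuclideanSpace ℝ (Fin 3)), (∀ k, x k 1 = 0 ∧ 0 ≤ x k 0) ∧ ∀ k : ℕ,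
        t k ∈ Ioo 0 X.T ∧ X.T / 2 < t k ∧ (k : ℝ) + 1 ≤ ‖X.u (t k) (x k)‖ ∧
        (∀ s ∈ Ioc 0 (t k), ∀ y, ‖X.u s y‖ ≤ (1 + 1 / ((k : ℝ) + 1)) * ‖X.u (t k) (x k)‖) ∧
        t k + δ / ‖X.u (t k) (x k)‖ ^ 2 < X.T ∧
        (∀ s ∈ Ioc 0 (t k + δ / ‖X.u (t k) (x k)‖ ^ 2), ∀ y,
          ‖X.u s y‖ ≤ 6 * ‖X.u (t k) (x k)‖) ∧
        (∀ s s' : ℝ, 0 ≤ s → s < s' → s' ≤ t k + δ / ‖X.u (t k) (x k)‖ ^ 2 → ∀ y,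
          ‖X.u s' y - UnboundedOperators.heatExtension (X.u s) (1 * (s' - s)) y +
              oseenDuhamel 1 s X.u X.u s' y‖ ≤ (s' - s) * G) := by
  obtain ⟨δ, hδ, G, hG0, t, x, hdata⟩ := X.exists_zoom_data
  choose θ hθ using fun k => exists_rotZ_mem_halfPlane (x k)
  have hM : ∀ k, ‖X.u (t k) (rotZ (θ k) (x k))‖ = ‖X.u (t k) (x k)‖ := fun k => by
    rw [hax (t k) ⟨(hdata k).1.1.le, (hdata k).1.2⟩ (θ k) (x k), norm_rotZ]
  refine ⟨δ, hδ, G, hG0, t, fun k => rotZ (θ k) (x k), hθ, fun k => ?_⟩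
  simp only [hM k]
  exact hdata k

/-! ## §3 The zoom with force, centres on the half-plane -/

/-- **THE ZOOM WITH FORCE, AXISYMMETRIC NORMALISATION** (`ν = 1`; axisymmetric datum and Clay
force; no named fact): the conclusion of `ClayBlowup.exists_zoom_limit` with the zoom centres `x_k`
on the meridian half-plane `{x₁ = 0, x₀ ≥ 0}`, so that every zoom slice is axisymmetric about the
vertical axis through `−c_k⁻¹ (x_k)₀ e₀` (`zoom_halfPlane_rot_about`).
[cite: KochNadirashviliSereginSverak2009, Prop 6.1 and proof of Thm 6.1 (arXiv pp. 11–12)] -/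
theorem exists_zoom_limit_halfPlane (X : ClayBlowup 1) (h0A : IsAxisymmetric (X.u 0))
    (hfA : ∀ t ∈ Ico 0 X.T, IsAxisymmetric (X.f t)) :
    ∃ (t : ℕ → ℝ) (x : ℕ → EuclideanSpace ℝ (Fin 3)) (c : ℕ → ℝ) (φ : ℕ → ℕ)
      (W : ℝ → EuclideanSpace ℝ (Fin 3) → EuclideanSpace ℝ (Fin 3)) (δ : ℝ),
      StrictMono φ ∧ 0 < δ ∧ (∀ k, t k ∈ Ioo 0 X.T) ∧ (∀ k, x k 1 = 0 ∧ 0 ≤ x k 0) ∧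
      (∀ k, c k = ‖X.u (t k) (x k)‖⁻¹) ∧
      (∀ k, 0 < c k ∧ c k ≤ 1) ∧ (∀ k : ℕ, (k : ℝ) + 1 ≤ ‖X.u (t k) (x k)‖) ∧
      (∀ k : ℕ, ∀ s ∈ Ioc 0 (t k), ∀ y, ‖X.u s y‖ ≤ (1 + 1 / ((k : ℝ) + 1)) * ‖X.u (t k) (x k)‖) ∧
      (∀ k, t k + δ * c k ^ 2 < X.T) ∧
      ContinuousOn (uncurry W) (Iio δ ×ˢ univ) ∧
      (∀ s < δ, IsWeaklyDivFree (W s)) ∧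
      (∀ s τ : ℝ, s < τ → τ < δ → ∀ y,
        W τ y = UnboundedOperators.heatExtension (W s) (τ - s) y - oseenDuhamel 1 s W W τ y) ∧
      (∀ s < δ, ∀ y, ‖W s y‖ ≤ 6) ∧ (∀ s ≤ 0, ∀ y, ‖W s y‖ ≤ 1) ∧ ‖W 0 0‖ = 1 ∧
      IsKNSSBlowupLimit W ∧
      IsBoundedWeakNSSolutionOn (Iio 0) isOpen_Iio 1 W ∧
      (∀ s < δ, TendstoLocallyUniformly
        (fun j => (c (φ j) • stPull (c (φ j) ^ 2) (c (φ j)) (t (φ j)) (x (φ j)) X.u) s) (W s) atTop) := by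
  have hax : ∀ t ∈ Ico 0 X.T, IsAxisymmetric (X.u t) := X.isAxisymmetric one_pos h0A hfA
  obtain ⟨δ, hδ, G, hG0, t, x, hhalf, hdata⟩ := X.exists_zoom_data_halfPlane hax
  obtain ⟨c, φ, W, hφ, hc, hc01, hlife, hWc, hWdiv, hWmild, hW6, hW1, hW0, hknss, hweak, hconv⟩ :=
    X.exists_zoom_limit_of_data hδ hG0 hdata
  exact ⟨t, x, c, φ, W, δ, hφ, hδ, fun k => (hdata k).1, hhalf, hc, hc01, fun k => (hdata k).2.2.1,
    fun k => (hdata k).2.2.2.1, hlife, hWc, hWdiv, hWmild, hW6, hW1, hW0, hknss, hweak, hconv⟩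

/-! ## §4 The zoom slices are axisymmetric about a vertical axis through `−M_k r(x_k) e₀` -/

/-- **With centres on the half-plane, the zoom slices are axisymmetric about the vertical axis
through `a_k = −(c_k⁻¹ (x_k)₀) e₀`** (the rescaled position of the physical axis): for every slice
time `t_k + c_k² s ∈ [0, T)`, every angle `θ` and every `y`,
`w_k(s, a_k + R_θ (y − a_k)) = R_θ w_k(s, y)`, where `w_k = c_k • stPull (c_k²) c_k t_k x_k u`
(`x_k + c_k a_k = (x_k)₂ e₂` lies ON the axis, and `u(t', ·)` is axisymmetric).
[cite: KochNadirashviliSereginSverak2009, proof of Thm 6.1 (arXiv p. 12)] -/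
theorem zoom_halfPlane_rot_about (X : ClayBlowup 1) (hax : ∀ t ∈ Ico 0 X.T, IsAxisymmetric (X.u t))
    {t₀ c : ℝ} (hc : 0 < c) {x₀ : EuclideanSpace ℝ (Fin 3)} (hx₁ : x₀ 1 = 0) {s : ℝ}
    (hs : t₀ + c ^ 2 * s ∈ Ico 0 X.T) (θ : ℝ) (y : EuclideanSpace ℝ (Fin 3)) :
    (c • stPull (c ^ 2) c t₀ x₀ X.u) s
        (-(c⁻¹ * x₀ 0) • EuclideanSpace.single 0 (1 : ℝ) +
          rotZ θ (y - -(c⁻¹ * x₀ 0) • EuclideanSpace.single 0 (1 : ℝ))) =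
      rotZ θ ((c • stPull (c ^ 2) c t₀ x₀ X.u) s y) := by
  set a : EuclideanSpace ℝ (Fin 3) := -(c⁻¹ * x₀ 0) • EuclideanSpace.single 0 (1 : ℝ) with ha
  rw [smul_stPull_apply, smul_stPull_apply]
  -- the physical points: `x₀ + c (a + R_θ (y − a)) = R_θ (x₀ + c y)` because `x₀ + c a` is on the axis
  have hax' := hax _ hs θ (x₀ + c • y)
  have hpt : x₀ + c • (a + rotZ θ (y - a)) = rotZ θ (x₀ + c • y) := by
    have hc0 : c ≠ 0 := hc.ne'
    ext i
    fin_cases i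
    · simp [ha, rotZ_apply_zero, hx₁]
      field_simp
      ring
    · simp [ha, rotZ_apply_one, hx₁]
      field_simp
      ring
    · simp [ha, rotZ_apply_two]
  rw [hpt, hax', rotZ_smul_vec]

end ClayBlowup

end Summit.NavierStokesRegularity.FluidComputer

end
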